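import Mathlib
import Summits.ResolutionOfSingularities.ResolutionOfSingularities.Theorems.RadicialJungCleanModelsCleanProp44SigmaTowerEnds
import HarnessLib

/-!
# Route `RadicialJung`, crux `CleanModels` (stmt-ResolutionOfSingularities-15917), line `Sketch` rev 35, stub 6 `stub_cleanProp44` (X44c):
# THE BASE OF THE σ-TOWER OVER THE RESIDUE FIELD ITSELF — the level-`0` inputs of ✓ `sigmaTower` / ✓ `sigmaTower_successor_top` with `κ(c) := 𝒪_{X,c}/𝔪_c`,
# `σ :=` the residue map, and the two level-`0` compatibilities `hΛC`, `hΛy` discharged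

Seat decomp-res-hand-2 g23 (structural hand); specialisation of ✓ `sigmaTower_base`.  ✓ `sigmaTower_successor_top` asks at level `0` for a `κ[u]`-structure on
`D_0 = A₀/(t_0, v_0)` which is a localization (`hloc₀`) and for two compatibilities with the first chart: `C(σ r) ↦ class of τ_R r` (`hΛC`) and `y_i ↦ class of uf_i`
(`hΛy`, `y = (0, 1, u)` up to the order of the chart indices).  With `κ(c)` taken to be the residue ring `𝒪_{X,c}/(c)` ITSELF (identity algebra, a localization at
its units by `IsLocalization.self`) and `σ = ` the quotient map, these are automatic for every `κ(c)[u]`-structure on `D_0` with `C r̄ ↦ class of e π♯ r` and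
`u ↦ class of e uf_{i₂}`:

* `sigmaTower_base_residueField` — chart index `i ≠ 0`, free index `i₂` (and `j ≠ i, j ≠ 0 ⟹ j = i₂`), fractions `uf` (`uf_i = 1`, `uf_0 ∈ 𝔪`),
  `IsRsopPart ![e uf_0, e π♯cᵢ]`, and for every such structure: `∃ N, IsLocalization N D_0` (`hloc₀`), `algebraMap 0 = class of e uf_0`,
  `algebraMap 1 = class of e uf_i`, `algebraMap u = class of e uf_{i₂}` (the three values of `hΛy` for `y_0 = 0`, `y_i = 1`, `y_{i₂} = u`).

Honest framing: OURS, specialisation only; nothing here proves X44c, any case of `CleanModels`, or resolution of singularities in characteristic `p`.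
[cite: StacksProject, Tag 0804, Tag 0BIQ] [cite: Matsumura1987, Thm. 14.2] [cite: CossartPiltant2008, Prop. 4.4 (proof, p. 11)]
-/

noncomputable section

set_option linter.dupNamespace false -- mandated namespace of this single-conjunct summit

open IsLocalRing CategoryTheory AlgebraicGeometry Polynomial
open Literature.AlgebraicGeometry.Resolution

namespace Summit.ResolutionOfSingularities.ResolutionOfSingularities.Theorems.RadicialJung.CleanModels

universe u

section BaseResidue

variable {X₀ X₁ : Scheme.{u}} {π : X₁ ⟶ X₀} {J₀ : X₀.IdealSheafData}

set_option maxHeartbeats 800000 in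
-- long statement; elaboration only
/-- **THE BASE OF THE σ-TOWER OVER `κ(c) = 𝒪_{X,c}/𝔪_c`** (see the module docstring). [cite: StacksProject, Tag 0804, Tag 0BIQ] [cite: Matsumura1987, Thm. 14.2]
[cite: CossartPiltant2008, Prop. 4.4 (proof, p. 11)] -/
theorem sigmaTower_base_residueField (hπ : IsBlowup π J₀) (x' : X₁) (hR : IsRegularLocalRing (X₀.presheaf.stalk (π x')))
    (c : Fin 3 → X₀.presheaf.stalk (π x'))
    (hz : Ideal.span (Set.range (Fin.append c (Fin.elim0 : Fin 0 → X₀.presheaf.stalk (π x')))) = maximalIdeal (X₀.presheaf.stalk (π x')))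
    (hdim : ringKrullDim (X₀.presheaf.stalk (π x')) = ((3 + 0 : ℕ) : WithBot ℕ∞))
    (hcJ : Ideal.span (Set.range c) = stalkIdeal J₀ (π x'))
    (hL : (π.stalkMap x').hom (c 0) ∈ (stalkIdeal J₀ (π x')).map (π.stalkMap x').hom * maximalIdeal (X₁.presheaf.stalk x'))
    (hJ0 : (stalkIdeal J₀ (π x')).map (π.stalkMap x').hom ≠ ⊥)
    {A₀ : Type u} [CommRing A₀] [IsLocalRing A₀] (e : X₁.presheaf.stalk x' ≃+* A₀) :
    ∃ (i i₂ : Fin 3) (uf : Fin 3 → X₁.presheaf.stalk x'), i ≠ 0 ∧ i₂ ≠ 0 ∧ i₂ ≠ i ∧ (∀ j : Fin 3, j ≠ i → j ≠ 0 → j = i₂) ∧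
      (∀ k, (π.stalkMap x').hom (c k) = (π.stalkMap x').hom (c i) * uf k) ∧ uf i = 1 ∧ uf 0 ∈ maximalIdeal (X₁.presheaf.stalk x') ∧
      IsRsopPart ![e (uf 0), e ((π.stalkMap x').hom (c i))] ∧
      (∀ inst₀ : Algebra (X₀.presheaf.stalk (π x') ⧸ Ideal.span (Set.range c))[X] (A₀ ⧸ Ideal.span (Set.range ![e (uf 0), e ((π.stalkMap x').hom (c i))])),
        (∀ r : X₀.presheaf.stalk (π x'),
          @algebraMap (X₀.presheaf.stalk (π x') ⧸ Ideal.span (Set.range c))[X] (A₀ ⧸ Ideal.span (Set.range ![e (uf 0), e ((π.stalkMap x').hom (c i))])) _ _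
            inst₀ (C (Ideal.Quotient.mk _ r)) = Ideal.Quotient.mk _ (e ((π.stalkMap x').hom r))) →
        @algebraMap (X₀.presheaf.stalk (π x') ⧸ Ideal.span (Set.range c))[X] (A₀ ⧸ Ideal.span (Set.range ![e (uf 0), e ((π.stalkMap x').hom (c i))])) _ _
            inst₀ Polynomial.X = Ideal.Quotient.mk _ (e (uf i₂)) →
        (∃ N : Submonoid (X₀.presheaf.stalk (π x') ⧸ Ideal.span (Set.range c))[X],
            @IsLocalization _ _ N (A₀ ⧸ Ideal.span (Set.range ![e (uf 0), e ((π.stalkMap x').hom (c i))])) _ inst₀) ∧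
          @algebraMap (X₀.presheaf.stalk (π x') ⧸ Ideal.span (Set.range c))[X] (A₀ ⧸ Ideal.span (Set.range ![e (uf 0), e ((π.stalkMap x').hom (c i))])) _ _
            inst₀ 0 = Ideal.Quotient.mk _ (e (uf 0)) ∧
          @algebraMap (X₀.presheaf.stalk (π x') ⧸ Ideal.span (Set.range c))[X] (A₀ ⧸ Ideal.span (Set.range ![e (uf 0), e ((π.stalkMap x').hom (c i))])) _ _
            inst₀ 1 = Ideal.Quotient.mk _ (e (uf i)) ∧
          @algebraMap (X₀.presheaf.stalk (π x') ⧸ Ideal.span (Set.range c))[X] (A₀ ⧸ Ideal.span (Set.range ![e (uf 0), e ((π.stalkMap x').hom (c i))])) _ _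
            inst₀ Polynomial.X = Ideal.Quotient.mk _ (e (uf i₂))) := by
  obtain ⟨i, i₂, uf, hi0, hi₂0, hi₂i, hrel, hufi, ht', hrs, -, hX⟩ := sigmaTower_base hπ x' hR c hz hdim hcJ hL hJ0 e
  obtain ⟨i₂', -, -, huniq⟩ := fin_three_exists_third i hi0
  have hi₂' : i₂ = i₂' := huniq i₂ hi₂i hi₂0
  refine ⟨i, i₂, uf, hi0, hi₂0, hi₂i, fun j hj hj0 => hi₂' ▸ huniq j hj hj0, hrel, hufi, ht', hrs, fun inst₀ hC hXu => ⟨?_, ?_, ?_, hXu⟩⟩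
  · -- `κ(c)` is a localization of itself at its units
    haveI : IsLocalization (IsUnit.submonoid (X₀.presheaf.stalk (π x') ⧸ Ideal.span (Set.range c)))
        (X₀.presheaf.stalk (π x') ⧸ Ideal.span (Set.range c)) := IsLocalization.self le_rfl
    exact hX (X₀.presheaf.stalk (π x') ⧸ Ideal.span (Set.range c)) (IsUnit.submonoid _) inst₀
      (fun g r hgr => by rw [Algebra.algebraMap_self, RingHom.id_apply] at hgr; rw [← hgr]; exact hC r) hXu
  · -- `0 = class of t_0`
    rw [map_zero, eq_comm, Ideal.Quotient.eq_zero_iff_mem]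
    exact Ideal.subset_span ⟨0, rfl⟩
  · -- `1 = class of uf_i = class of 1`
    rw [map_one, hufi, map_one, map_one]

end BaseResidue

end Summit.ResolutionOfSingularities.ResolutionOfSingularities.Theorems.RadicialJung.CleanModels

end
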